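import Summits.Ventures.QEC.Census.CertBZInfoSets
import Summits.Ventures.QEC.Census.BB.A1s_n144_k16_cce5fef4.Cert
import HarnessLib

/-!
# Census row `A1s_n144_k16_cce5fef4` — `bz_aut` certificate `b00bd068d90da96d`, side `Z`: INFORMATION-SET facts `bzZSys` (file 2/2) and the block BOUNDS `bzZBound` at tier KERNEL
# (qec-search-10 g3; `decide +kernel` each; consumed by `Distance.lean` via `DistCert.bzZBlock_of_parts`)
-/

namespace Summit.Ventures.QEC.Census.A1s_n144_k16_cce5fef4

open Summit.Ventures.QEC.Census

/-- Block 30, matrix 0 (`|T| = 72`, depth 2): systematic on `T`, rows `< 2^144` (KERNEL). -/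
theorem autSysZ_30_0 : A1s_n144_k16_cce5fef4.cert.bzZSys A1s_n144_k16_cce5fef4.bzAutData 30 0 = true := by
  decide +kernel

/-- Block 30, matrix 1 (`|T| = 72`, depth 3): systematic on `T`, rows `< 2^144` (KERNEL). -/
theorem autSysZ_30_1 : A1s_n144_k16_cce5fef4.cert.bzZSys A1s_n144_k16_cce5fef4.bzAutData 30 1 = true := by
  decide +kernel

/-- Block 31, matrix 0 (`|T| = 72`, depth 2): systematic on `T`, rows `< 2^144` (KERNEL). -/
theorem autSysZ_31_0 : A1s_n144_k16_cce5fef4.cert.bzZSys A1s_n144_k16_cce5fef4.bzAutData 31 0 = true := by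
  decide +kernel

/-- Block 31, matrix 1 (`|T| = 72`, depth 3): systematic on `T`, rows `< 2^144` (KERNEL). -/
theorem autSysZ_31_1 : A1s_n144_k16_cce5fef4.cert.bzZSys A1s_n144_k16_cce5fef4.bzAutData 31 1 = true := by
  decide +kernel

end Summit.Ventures.QEC.Census.A1s_n144_k16_cce5fef4
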